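import Summits.PneNP.PneNP.Theorems.SymmetryBudgetWindowCanoniserSemRefine

/-!
# Window canoniser, XVI: gate semantics — the shared root refinement

Route `PneNP/SymmetryBudget`, dichotomy `WindowBarrier` (stmt-PneNP-2145) / `NoHiddenOrder` (stmt-PneNP-14781);
continuation of `…WindowCanoniserSemRefine.lean`.  The shared gates `rLT rd u w` run ordered colour refinement
of the whole window graph from the constant colouring: **`rLT rd u w ↔ ocrIter (within (G x) univ)
(liftCol univ 0) rd u < … w`** (`WCan.ev_aRLT`), so `rLT n` holds the order of the root colouring
`CGCanon.crRefine (G x) univ 0` of the replay (`WCan.initSt`).  Same round structure as `…SemRefine.lean`.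
-/

-- `Summit.PneNP.PneNP.…` duplicates `PneNP` BY DESIGN (single-problem summit, D-0017 layout).
set_option linter.dupNamespace false

noncomputable section

namespace Summit.PneNP.PneNP.Theorems

namespace WCan

open Finset Literature.Computability.Complexity Literature.Computability.Complexity.CGCanon
  Literature.Combinatorics.SimpleGraph
open scoped Classical

variable {K r n : ℕ} [NeZero n] (x : Fin (r + n) × Fin (r + n) → Bool)

/-- The root colouring after `rd` rounds. -/
abbrev colZ (x : Fin (r + n) × Fin (r + n) → Bool) (rd : ℕ) : Fin n → ℕ :=
  ocrIter (within (G x) univ) (liftCol (univ : Finset (Fin n)) fun _ => 0) rd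

/-- **Round `0`**: `rLT 0 u w` is false, and the initial colouring is constant. -/
theorem ev_aRLT_zero (u w : Fin n) : ev x (aRLT (K := K) (r := r) 0 u w) = decide (colZ x 0 u < colZ x 0 w) := by
  have : colZ x 0 u = colZ x 0 w := by simp [colZ, liftCol]
  rw [this, decide_eq_false (lt_irrefl _)]
  show Vl K x _ = false
  rw [Vl_eq]
  show (GateFn.and 1).2 (fun i => GateDAG.wire x (Vl K x) (SKind.args (K := K) .rLT (prm (vec2 u w) (rd := ⟨0, Nat.succ_pos n⟩)) i)) = false
  simp only [GateFn.and, SKind.args, prm_rd, wire_wA, ev_ff, decide_eq_false_iff_not, Fin.forall_fin_one]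
  exact Bool.false_ne_true

section Round

variable {x} {rd : Fin (n + 1)} (hrd : (rd : ℕ) < n)
  (hLT : ∀ a b, ev x (aRLT (K := K) (r := r) rd a b) = decide (colZ x rd a < colZ x rd b))
include hLT

/-- Equal colours at round `rd`, from the strict-order gates. -/
theorem colZ_eq_iff (a b : Fin n) : (ev x (aRLT (K := K) (r := r) rd a b) = false ∧ ev x (aRLT (K := K) (r := r) rd b a) = false) ↔
    colZ x rd a = colZ x rd b := by
  have h1 := hLT a b; have h2 := hLT b a
  constructor
  · rintro ⟨ha, hb⟩
    rw [ha] at h1; rw [hb] at h2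
    have := (decide_eq_false_iff_not).1 h1.symm
    have := (decide_eq_false_iff_not).1 h2.symm
    omega
  · intro he
    constructor
    · rw [h1]; exact decide_eq_false (by omega)
    · rw [h2]; exact decide_eq_false (by omega)

/-- The "adjacent, in the class of `w`" block wire. -/
theorem wire_rae (u w' w : Fin n) :
    GateDAG.wire x (Vl K x) (w1 (n1and [adjLit u w', neg (aRLT (K := K) (r := r) rd w' w), neg (aRLT (K := K) (r := r) rd w w')])) = true ↔
      ((within (G x) univ).Adj u w' ∧ colZ x rd w' = colZ x rd w) := by
  rw [wire_w1, Vl_n1and x _ (by simp), ← colZ_eq_iff hLT w' w]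
  simp only [List.mem_cons, List.not_mem_nil, or_false, forall_eq_or_imp, forall_eq, holds_neg, holds_adjLit, within_adj,
    mem_univ, true_and]

/-- Its negated companion. -/
theorem wire_rnae (v w' w : Fin n) :
    GateDAG.wire x (Vl K x) (w1 (n1or [nadjLit v w', pos (aRLT (K := K) (r := r) rd w' w), pos (aRLT (K := K) (r := r) rd w w')])) = true ↔
      ¬ ((within (G x) univ).Adj v w' ∧ colZ x rd w' = colZ x rd w) := by
  rw [wire_w1, Vl_n1or x _ (by simp), ← colZ_eq_iff hLT w' w]
  simp only [List.mem_cons, List.not_mem_nil, or_false, exists_eq_or_imp, exists_eq_left, holds_pos, holds_nadjLit, within_adj,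
    mem_univ, true_and]
  cases ev x (aRLT (K := K) (r := r) rd w' w) <;> cases ev x (aRLT (K := K) (r := r) rd w w')
  all_goals simp

/-- The counting gadget at the root. -/
theorem ev_aRcge (u v w : Fin n) : ev x (aRcge (K := K) (r := r) rd u v w) = true ↔
    nbrCount (within (G x) univ) (colZ x rd) v (colZ x rd w) ≤ nbrCount (within (G x) univ) (colZ x rd) u (colZ x rd w) := by
  show Vl K x _ = true ↔ _
  rw [Vl_eq]
  show decide (n + n ≤ 2 * GateFn.numOnes (fun i : Fin (n + n) => GateDAG.wire x (Vl K x)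
    (SKind.args (K := K) .rcge (prm (vec3 u v w) (rd := rd)) i))) = true ↔ _
  rw [decide_eq_true_iff]
  simp only [SKind.args, prm_vs, prm_rd, vec3_0, vec3_1, vec3_2]
  have happ : (fun i : Fin (n + n) => GateDAG.wire x (Vl K x) (Fin.append
      (fun w' => w1 (n1and [adjLit u w', neg (aRLT rd w' w), neg (aRLT rd w w')]))
      (fun w' => w1 (n1or [nadjLit v w', pos (aRLT rd w' w), pos (aRLT rd w w')])) i)) =
      Fin.append (fun w' => decide ((within (G x) univ).Adj u w' ∧ colZ x rd w' = colZ x rd w))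
        (fun w' => decide (¬ ((within (G x) univ).Adj v w' ∧ colZ x rd w' = colZ x rd w))) := by
    funext i
    induction i using Fin.addCases with
    | left i => rw [Fin.append_left, Fin.append_left]; exact Bool.eq_iff_iff.2 (by rw [wire_rae hLT, decide_eq_true_iff])
    | right j => rw [Fin.append_right, Fin.append_right]; exact Bool.eq_iff_iff.2 (by rw [wire_rnae hLT, decide_eq_true_iff])
  rw [happ, Literature.Computability.AlgebraicComplexity.LabelledArithCircuit.numOnes_append, numOnes_eq_card, numOnes_eq_card]
  have hA : (univ.filter fun w' => decide ((within (G x) univ).Adj u w' ∧ colZ x rd w' = colZ x rd w) = true).card =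
      nbrCount (within (G x) univ) (colZ x rd) u (colZ x rd w) := by
    unfold nbrCount; congr 1; ext w'; simp
  have hB : (univ.filter fun w' => decide (¬ ((within (G x) univ).Adj v w' ∧ colZ x rd w' = colZ x rd w)) = true).card =
      n - nbrCount (within (G x) univ) (colZ x rd) v (colZ x rd w) := by
    have : (univ.filter fun w' => decide (¬ ((within (G x) univ).Adj v w' ∧ colZ x rd w' = colZ x rd w)) = true) =
        univ \ univ.filter fun w' => (within (G x) univ).Adj v w' ∧ colZ x rd w' = colZ x rd w := by
      ext w'; simp only [mem_filter, mem_univ, true_and, decide_eq_true_eq, mem_sdiff]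
    rw [this, card_univ_sdiff, Fintype.card_fin]
    unfold nbrCount; congr 2
  rw [hA, hB]
  have : nbrCount (within (G x) univ) (colZ x rd) v (colZ x rd w) ≤ n := (card_filter_le _ _).trans_eq (by simp)
  omega

/-- `rallb` at the root. -/
theorem ev_aRallb (u v w : Fin n) : ev x (aRallb (K := K) (r := r) rd u v w) = true ↔
    ∀ w', colZ x rd w' < colZ x rd w → nbrCount (within (G x) univ) (colZ x rd) u (colZ x rd w') =
      nbrCount (within (G x) univ) (colZ x rd) v (colZ x rd w') := by
  show Vl K x _ = true ↔ _
  rw [Vl_eq]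
  show (GateFn.and n).2 (fun i => GateDAG.wire x (Vl K x) (SKind.args (K := K) .rallb (prm (vec3 u v w) (rd := rd)) i)) = true ↔ _
  simp only [GateFn.and, decide_eq_true_iff, SKind.args, prm_vs, prm_rd, vec3_0, vec3_1, vec3_2, wire_w2]
  have hw : ∀ w' : Fin n, Vl K x (.f2 (n2or [litN1 (neg (aRLT rd w' w)), n1and [pos (aRcge rd u v w'), pos (aRcge rd v u w')]])) = true ↔
      (colZ x rd w' < colZ x rd w → nbrCount (within (G x) univ) (colZ x rd) u (colZ x rd w') =
        nbrCount (within (G x) univ) (colZ x rd) v (colZ x rd w')) := by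
    intro w'
    rw [Vl_n2or x _ (by simp)]
    simp only [List.mem_cons, List.not_mem_nil, or_false, exists_eq_or_imp, exists_eq_left, Vl_litN1, holds_neg, hLT,
      decide_eq_false_iff_not]
    rw [Vl_n1and x _ (by simp)]
    simp only [List.mem_cons, List.not_mem_nil, or_false, forall_eq_or_imp, forall_eq, holds_pos, ev_aRcge hLT]
    constructor
    · rintro (h1 | ⟨h1, h2⟩) hlt
      · exact absurd hlt h1
      · exact le_antisymm h2 h1
    · intro himp
      by_cases hlt : colZ x rd w' < colZ x rd w
      · exact Or.inr ⟨(himp hlt).ge, (himp hlt).le⟩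
      · exact Or.inl hlt
  simp only [hw]

/-- `rlex` at the root: `ProfLT`. -/
theorem ev_aRlex (u v : Fin n) : ev x (aRlex (K := K) (r := r) rd u v) = true ↔ ProfLT (within (G x) univ) (colZ x rd) u v := by
  show Vl K x _ = true ↔ _
  rw [Vl_eq]
  show (GateFn.or n).2 (fun i => GateDAG.wire x (Vl K x) (SKind.args (K := K) .rlex (prm (vec2 u v) (rd := rd)) i)) = true ↔ _
  simp only [GateFn.or, decide_eq_true_iff, SKind.args, prm_vs, prm_rd, vec2_0, vec2_1, wire_w1]
  have hw : ∀ w : Fin n, Vl K x (.f1 (n1and [neg (aRcge rd u v w), pos (aRallb rd u v w)])) = true ↔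
      (nbrCount (within (G x) univ) (colZ x rd) u (colZ x rd w) < nbrCount (within (G x) univ) (colZ x rd) v (colZ x rd w) ∧
        ∀ w', colZ x rd w' < colZ x rd w → nbrCount (within (G x) univ) (colZ x rd) u (colZ x rd w') =
          nbrCount (within (G x) univ) (colZ x rd) v (colZ x rd w')) := by
    intro w
    rw [Vl_n1and x _ (by simp)]
    simp only [List.mem_cons, List.not_mem_nil, or_false, forall_eq_or_imp, forall_eq, holds_pos, holds_neg, ev_aRallb hLT,
      and_congr_left_iff]
    intro _
    rw [← not_le]
    have := ev_aRcge (K := K) (r := r) hLT u v w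
    cases hh : ev x (aRcge (K := K) (r := r) rd u v w)
    · rw [hh] at this; simp only [Bool.false_eq_true, false_iff] at this; simp [this]
    · rw [hh] at this; simp only [true_iff] at this; simp [this]
  simp only [hw, ProfLT]

/-- The step at the root. -/
theorem ev_aRLT_succ (u w : Fin n) : ev x (aRLT (K := K) (r := r) ⟨rd + 1, by omega⟩ u w) =
    decide (colZ x (rd + 1) u < colZ x (rd + 1) w) := by
  apply Bool.eq_iff_iff.2
  show Vl K x _ = true ↔ _
  rw [Vl_eq, decide_eq_true_iff]
  show (GateFn.and 1).2 (fun i => GateDAG.wire x (Vl K x) (SKind.args (K := K) .rLT (prm (vec2 u w) (rd := ⟨rd + 1, by omega⟩)) i)) = true ↔ _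
  simp only [GateFn.and, decide_eq_true_iff, SKind.args, prm_vs, prm_rd, vec2_0, vec2_1, Fin.forall_fin_one, wire_w2]
  rw [Vl_n2or x _ (by simp)]
  simp only [List.mem_cons, List.not_mem_nil, or_false, exists_eq_or_imp, exists_eq_left, Vl_litN1, holds_pos, Fin.eta, hLT,
    decide_eq_true_eq]
  rw [Vl_n1and x _ (by simp)]
  simp only [List.mem_cons, List.not_mem_nil, or_false, forall_eq_or_imp, forall_eq, holds_pos, holds_neg, ev_aRlex hLT]
  rw [show (ev x (aRLT (K := K) (r := r) rd u w) = false ∧ ev x (aRLT (K := K) (r := r) rd w u) = false ∧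
      ProfLT (within (G x) univ) (colZ x rd) u w) ↔
    ((ev x (aRLT (K := K) (r := r) rd u w) = false ∧ ev x (aRLT (K := K) (r := r) rd w u) = false) ∧
      ProfLT (within (G x) univ) (colZ x rd) u w) from and_assoc.symm, colZ_eq_iff hLT]
  show _ ↔ ocrIter (within (G x) univ) (liftCol univ fun _ => 0) (rd + 1) u < ocrIter (within (G x) univ) (liftCol univ fun _ => 0) (rd + 1) w
  rw [ocrIter_succ, ocrStep_lt_iff]
  rfl

end Round

/-- **The root refinement gates compute ordered colour refinement of the window graph.** -/
theorem ev_aRLT (rd : Fin (n + 1)) (u w : Fin n) : ev x (aRLT (K := K) (r := r) rd u w) = decide (colZ x rd u < colZ x rd w) := by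
  obtain ⟨rv, hrv⟩ := rd
  induction rv generalizing u w with
  | zero => exact ev_aRLT_zero x u w
  | succ rv ih => exact ev_aRLT_succ (rd := ⟨rv, by omega⟩) (by simp; omega) (fun a b => ih a b (by omega)) u w

/-- **After `n` rounds: the order of the root colouring `crRefine (G x) univ 0`.** -/
theorem ev_aRLT_last (u w : Fin n) : ev x (aRLT (K := K) (r := r) (Fin.last n) u w) =
    decide (crRefine (G x) univ (fun _ => 0) u < crRefine (G x) univ (fun _ => 0) w) :=
  ev_aRLT x (Fin.last n) u w

end WCan

end Summit.PneNP.PneNP.Theorems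

end
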